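import Summits.QuantumFields.BalabanUV.Beta.GAN24.WardResidualFieldTotals
import Summits.QuantumFields.BalabanUV.Beta.GAN24.HessianTablePlainCharge

/-!
# `BalabanUV.Beta.GAN24.WardGammaPlainRowCentred` — binder row G-an2-4 ∕ (CONV-C), CT-W «WC-TL» → «QR-LL», the (S) row of RULING R-gan24p1-g27-1: **THE PLAIN SUB-ROW OF (W-γ)
# AT THE CENTRED ROOT, ASSEMBLED** — with (T-F) (`WardResidualFieldTotals`) for the field half and the vanishing of the `M1` letter's plain pair charges at Bałaban's centre
# (`HessianTablePlainCharge`), the PLAIN (ω ≡ 1) charge of the (γ) comb letter per slot is `−2·(cVH·wVH_j)·(σ_j·Lc^{d+1})⁻¹ · Σ_κ W^{α⁺}_κ(ν,y′)·ζS κ` — the multiplier term is GONE;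
# the one displayed input left is the within-block slot-constancy `ζS` of the plain `S_j`-charges (road-P2 chair `b2b-balaban-gan24-p2`, gen 40, INTENT 5)

NOT IN PRINT; OUR BOOKKEEPING ([folklore] assembly BY NAME of my INTENT 3 `WardResidualFieldTotals.hasSum_comb_gaugeCharge_plain` and INTENT 4 `HessianTablePlainCharge.plainCharge_hessFFAt_eq ∕
_eq_zero_of_centred`, leaf-02 g47's support lemmas `HessianGaugeLegContact.hessFFAt_inl_inl_eq_zero_of_not_mem(_right)`, one `tsum_prod'` on a finitely supported family; 0 `def`, 0 cited fact,
0 `def … : Prop`, 0 sorry).  HONEST FRAMING (cell contract, verbatim): «discharging `BetaPertH` makes Bałaban's UV stability UNCONDITIONAL — a real constructive-QFT result; it is NOT the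
continuum limit and NOT the Clay problem.»  HONEST DEPENDENCY (verbatim): «continuum YM on T⁴ ⇐ BetaPertH ∧ nine spine estimates (0/9 proved); BetaPertH ⇐ (D1) ∧ (D4) ∧ CAP+tail; G-an2-4 gates
asym, D1 and NE2/3/4.»

* §1 `summable_prod_hessFFAt`, **`tsum_prod_hessFFAt_eq`** (the pair-indexed plain charge `Σ'_{(x,z)} H_b x z (inl a)(inl b′)` = INTENT 4's closed form; `Equiv.prodComm` + `tsum_prod'`).
* §2 **`tsum_prod_M1At_eq_zero_of_centred`**: at the centred root (`2r_c + 1 = Lc`) EVERY plain pair charge of EVERY `M1At … ρ′ w`, in EVERY channel `(a, b) : Fib × Fib`, is `0`.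
* §3 **`hasSum_comb_gaugeCharge_plain_centred`**: the plain (ω ≡ 1) charge of the (γ) comb letter at slot `(ν, y′)`, channel `(a,b)`, given slot-constant plain `S_j`-charges `ζS` (DISPLAYED per channel),
  is `Σ_κ (−2·(cVH·wVH d Lc j)·(stepScale d Lc j·Lc^{d+1})⁻¹·W^{α⁺}_κ(ν,y′))·ζS κ` — no `ζM`, no multiplier read weights.
  SATISFIABLE CLASS OF THE DISPLAYED `hζS` (leaf-02 g56's located note N-leaf02-g56-1, journal 2026-08-22 l.44291): field–field channels `(inl α, inl β)` — at level `0`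
  with `ζS ≡ 0` (leaf-02 g55's `WilsonLetterFlatCharges.tsum_tsum_spureRecAt_zero_inl_inl`; pair-indexed form in their `SpureSlotChargeLevelZero`), at level `j+1` OPEN (it is the slot-constancy of
  the EXIT⊗EXIT pairing of the level-`j` vertex `⟨exit_α ⊗ exit_β, vertexOfK G_j Lc (SrecAt j) κ′ u′⟩`, leaf-02 g52's `CubicPushFaceCharge.hasSum_prod_SpureRecAt_succ_inl_inl` — the exit-type pairing law one level
  down); field–multiplier channels `(inl α, inr μ)` ∕ `(inr μ, inl α)`: UNSATISFIABLE at every level (the `cVH·wVH_j • vhSAt` border's plain charge is AFFINE in the slot `u`, leaf-02 g47's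
  `BorderGaugeLegContact.tsum_dz_mul_vhSAt` at `ψ = x_α`; road-P2 g39's E26g VH rows show the spread).  So §3–§4 serve the FIELD–FIELD read-out of the (γ) letter — the one the END's sandwich
  read-out keeps (`MultiplierZeroMass.hasSum_KInvStep_mm_left ∕ _right` kill the multiplier-leg blocks); for the fm channels the plain sub-row is NOT a consequence of (T-F).
* §4 the ℕ bridge `ctrOff_centred` (`Lc` odd ⇒ `2·ctrOff + 1 = Lc`, node 5ρ's `two_mul_half_add_one`) and the instances **`tsum_prod_M1At_ctr_eq_zero`**, **`hasSum_comb_gaugeCharge_plain_ctr`**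
  at Bałaban's centre `ρ_c = toSite (ctrOff (d+1) Lc)` — hypotheses: `Odd Lc` and the displayed `ζS` only.
Asserts NO value of Bałaban's tables beyond their typed letters; the slot-constancy `ζS` is displayed, not proved; discharges NOTHING of (S) beyond the plain sub-row ∕ (Q-R) ∕ (LT) ∕ (Q-L) ∕
(C) ∕ «T2Shape» ∕ «T2Drift» ∕ (hW, hWall); NEVER «G-an2-4 closed» as (CONV-C); NOT D1, NOT BetaPertH, NOT continuum, NOT Clay.  2026-08-22; no existing file touched.
-/

noncomputable section

open Finset
open scoped BigOperators
open Literature.MathematicalPhysics.QuantumFieldTheory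
open Literature.MathematicalPhysics.QuantumFieldTheory.Balaban1983to89
open Literature.MathematicalPhysics.QuantumFieldTheory.Balaban1983to89.Beta
open ExpKernelCalculus (Site MKer comp)
open AffineAveraging (box toSite)
open AveragingContoursRooted (ctrOff ctrOff_mem_box two_mul_half_add_one)
open AveragingContours (blk)
open AveragingHessianKernelsRooted (hessFFAt hessFFAt_inl_inr hessFFAt_inr)
open OneStepResolventKernel (Fib wsum)
open OneStepKernelFamily (KInvStep colH)
open SecondOrderResponse (dM)
open InterLevelTransport (cwsum)
open BalabanStepJetsSucc (wVH)
open Summit.QuantumFields.BalabanUV.Beta.AxialDressingRooted (coDressKBmAt)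
open Summit.QuantumFields.BalabanUV.Beta.BorderedHessian (stepScale)
open Summit.QuantumFields.BalabanUV.Beta.SpineRooted (SpureRecAt M1At)
open Summit.QuantumFields.BalabanUV.Beta.KernelWardRelative (gaugeWt)
open Summit.QuantumFields.BalabanUV.Beta.LinearGaugeVH (nearBox)
open Summit.QuantumFields.BalabanUV.Beta.GAN24.HessianGaugeLegContact (hessFFAt_inl_inl_eq_zero_of_not_mem hessFFAt_inl_inl_eq_zero_of_not_mem_right)
open Summit.QuantumFields.BalabanUV.Beta.GAN24.HessianTablePlainCharge (plainCharge_hessFFAt_eq)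
open Summit.QuantumFields.BalabanUV.Beta.GAN24.WardResidualFieldTotals (hasSum_comb_gaugeCharge_plain)

namespace Summit.QuantumFields.BalabanUV.Beta.GAN24.WardGammaPlainRowCentred

variable {d : ℕ}

/-! ## §1 The pair-indexed plain charge of the rooted constraint-Hessian table -/

/-- [folklore] The table `H_b = hessFFAt ρ L μ w` is finitely supported in its two fluctuation sites (both in the support box of `b`), hence summable on `Site × Site`. -/
theorem summable_prod_hessFFAt {L : ℕ} {r : Fin (d + 1) → ℕ} (hr : r ∈ box (d + 1) L) (μ : Fin (d + 1)) (w : Site (d + 1)) (a b' : Fin (d + 1)) :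
    Summable fun xz : Site (d + 1) × Site (d + 1) => hessFFAt (toSite r) L μ w xz.1 xz.2 (Sum.inl a) (Sum.inl b') := by
  classical
  refine summable_of_ne_finset_zero (s := nearBox L w ×ˢ nearBox L w) fun xz hxz => ?_
  rw [Finset.mem_product, not_and_or] at hxz
  rcases hxz with h | h
  · exact hessFFAt_inl_inl_eq_zero_of_not_mem hr μ w xz.2 a b' h
  · exact hessFFAt_inl_inl_eq_zero_of_not_mem_right hr μ w xz.1 a b' h

/-- NOT IN PRINT; OUR BOOKKEEPING.  **THE PAIR-INDEXED PLAIN CHARGE OF `H_b` IN CLOSED FORM**: `Σ'_{(x,z)} hessFFAt ρ L μ w x z (inl a)(inl b′) = L·(𝟙[b′ = μ]((L−1)/2 − r_a) − 𝟙[a = μ]((L−1)/2 − r_{b′}))`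
(INTENT 4's iterated form, `Equiv.prodComm` + `Summable.tsum_prod'`). -/
theorem tsum_prod_hessFFAt_eq {L : ℕ} (hL : 1 ≤ L) {r : Fin (d + 1) → ℕ} (hr : r ∈ box (d + 1) L) (μ : Fin (d + 1)) (w : Site (d + 1)) (a b' : Fin (d + 1)) :
    ∑' xz : Site (d + 1) × Site (d + 1), hessFFAt (toSite r) L μ w xz.1 xz.2 (Sum.inl a) (Sum.inl b')
      = (L : ℝ) * ((if b' = μ then ((L : ℝ) - 1) / 2 - (r a : ℝ) else 0) - (if a = μ then ((L : ℝ) - 1) / 2 - (r b' : ℝ) else 0)) := by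
  classical
  have hg : Summable fun zx : Site (d + 1) × Site (d + 1) => hessFFAt (toSite r) L μ w zx.2 zx.1 (Sum.inl a) (Sum.inl b') :=
    (Equiv.prodComm (Site (d + 1)) (Site (d + 1))).summable_iff.mpr (summable_prod_hessFFAt hr μ w a b')
  have hg1 : ∀ z : Site (d + 1), Summable fun x : Site (d + 1) => hessFFAt (toSite r) L μ w x z (Sum.inl a) (Sum.inl b') := fun z =>
    summable_of_ne_finset_zero (s := nearBox L w) fun x hx => hessFFAt_inl_inl_eq_zero_of_not_mem hr μ w z a b' hx
  rw [← (Equiv.prodComm (Site (d + 1)) (Site (d + 1))).tsum_eq (fun xz : Site (d + 1) × Site (d + 1) => hessFFAt (toSite r) L μ w xz.1 xz.2 (Sum.inl a) (Sum.inl b'))]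
  simp only [Equiv.prodComm_apply, Prod.fst_swap, Prod.snd_swap]
  rw [hg.tsum_prod' hg1, plainCharge_hessFFAt_eq hL hr]

/-! ## §2 At the centred root the `M1` letter is charge-free in the plain currency -/

/-- NOT IN PRINT; OUR BOOKKEEPING.  **AT THE CENTRED ROOT EVERY PLAIN PAIR CHARGE OF EVERY `M1At` VANISHES, IN EVERY CHANNEL**: for `2r_c + 1 = Lc` (all `c`),
`Σ'_{(x,z)} M1At d Lc ρ cΛ j ρ′ w x z a b = 0` (`M1At = (cΛ·wM1_j) • hessFFAt`: the `(inl, inl)` channels by INTENT 4, the others are `0` letterwise). -/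
theorem tsum_prod_M1At_eq_zero_of_centred {Lc : ℕ} [NeZero Lc] (hLc : 1 ≤ Lc) {r : Fin (d + 1) → ℕ} (hr : r ∈ box (d + 1) Lc)
    (hc : ∀ c : Fin (d + 1), 2 * (r c : ℝ) + 1 = Lc) (cΛ : ℝ) (j : ℕ) (ρ' : Fin (d + 1)) (w : Site (d + 1)) (a b : Fib d) :
    ∑' xz : Site (d + 1) × Site (d + 1), M1At d Lc (toSite r) cΛ j ρ' w xz.1 xz.2 a b = 0 := by
  rcases a with a | a <;> rcases b with b | b
  · simp only [M1At, Pi.smul_apply, smul_eq_mul]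
    rw [tsum_mul_left, tsum_prod_hessFFAt_eq hLc hr]
    have e1 : ((Lc : ℝ) - 1) / 2 - (r a : ℝ) = 0 := by have := hc a; linarith
    have e2 : ((Lc : ℝ) - 1) / 2 - (r b : ℝ) = 0 := by have := hc b; linarith
    rw [e1, e2]; simp
  · simp [M1At, hessFFAt_inl_inr]
  · simp [M1At, hessFFAt_inr]
  · simp [M1At, hessFFAt_inr]

/-! ## §3 The plain (γ) charge per slot at the centred root -/

/-- NOT IN PRINT; OUR BOOKKEEPING.  **THE PLAIN SUB-ROW OF (W-γ) AT THE CENTRED ROOT, ASSEMBLED**: for `Lc ≥ 1`, a CENTRED in-block root (`2r_c + 1 = Lc`), every level `j`, `cE cVH cΛ`,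
label `y`, slot `(ν, y′)`, channel `(a, b)`, and slot-constant PLAIN `S_j`-charges `Σ'_{(x,z)} S_j κ u x z a b = ζS κ` (DISPLAYED — the within-block constancy; block-periodicity is
road-P2's `pairCharge_SpureRecAt_block`; SATISFIABLE in the field–field channels only — `ζS ≡ 0` at level `0`, OPEN at level `j+1`; UNSATISFIABLE in the field–multiplier channels, where the
VH border's plain charge is affine in the slot — see the header), the PLAIN charge of the (γ) comb letter is
`Σ_κ (−2·(cVH·wVH d Lc j)·(stepScale d Lc j·Lc^{d+1})⁻¹·W^{α⁺}_κ(ν,y′))·ζS κ` — (T-F) on the field half, INTENT 4 on the multiplier half (`ζM ≡ 0`), no multiplier read weight left. -/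
theorem hasSum_comb_gaugeCharge_plain_centred {Lc : ℕ} [NeZero Lc] (hLc : 1 ≤ Lc) {r : Fin (d + 1) → ℕ} (hr : r ∈ box (d + 1) Lc)
    (hc : ∀ c : Fin (d + 1), 2 * (r c : ℝ) + 1 = Lc) (cE cVH cΛ : ℝ) (j : ℕ) (y : Site (d + 1)) (ν : Fin (d + 1)) (y' : Site (d + 1)) (a b : Fib d)
    {ζS : Fin (d + 1) → ℝ} (hζS : ∀ κ u, ∑' xz : Site (d + 1) × Site (d + 1), SpureRecAt d Lc (toSite r) cE cVH cΛ j κ u xz.1 xz.2 a b = ζS κ) :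
    HasSum (fun xz : Site (d + 1) × Site (d + 1) =>
        (∑ κ, wsum (fun u => ∑' x₂, ∑ κ₂,
              comp (coDressKBmAt (toSite r) Lc (KInvStep (d := d) Lc j))
                (dM (coDressKBmAt (toSite r) Lc (KInvStep (d := d) Lc j)) Lc (SpureRecAt d Lc (toSite r) cE cVH cΛ j) (M1At d Lc (toSite r) cΛ j) ν y')
                u x₂ (Sum.inl κ) (Sum.inl κ₂) * gaugeWt Lc y κ₂ x₂) (SpureRecAt d Lc (toSite r) cE cVH cΛ j κ)
          + ∑ ρ', cwsum Lc (fun w => ∑' x₂, ∑ κ₂,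
              comp (coDressKBmAt (toSite r) Lc (KInvStep (d := d) Lc j))
                (dM (coDressKBmAt (toSite r) Lc (KInvStep (d := d) Lc j)) Lc (SpureRecAt d Lc (toSite r) cE cVH cΛ j) (M1At d Lc (toSite r) cΛ j) ν y')
                ((Lc : ℤ) • w) x₂ (Sum.inr ρ') (Sum.inl κ₂) * gaugeWt Lc y κ₂ x₂) (M1At d Lc (toSite r) cΛ j ρ')) xz.1 xz.2 a b)
      (∑ κ, ((-(2 * (cVH * wVH d Lc j) * (stepScale d Lc j * (Lc : ℝ) ^ (d + 1))⁻¹)) *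
            ∑' u, colH (coDressKBmAt (toSite r) Lc (KInvStep (d := d) Lc j)) Lc ν y' κ u
              * ((if y' + Pi.single ν 1 = y then (1 / 2 : ℝ) else 0) - (if blk Lc (u + Pi.single κ 1) = y then (1 / 2 : ℝ) else 0))) * ζS κ) := by
  have hζS' : ∀ κ u, ∑' xz : Site (d + 1) × Site (d + 1), (1 : ℝ) * SpureRecAt d Lc (toSite r) cE cVH cΛ j κ u xz.1 xz.2 a b = ζS κ := fun κ u => by
    simp only [one_mul]; exact hζS κ u
  have hζM' : ∀ ρ' w, ∑' xz : Site (d + 1) × Site (d + 1), (1 : ℝ) * M1At d Lc (toSite r) cΛ j ρ' w xz.1 xz.2 a b = (fun _ : Fin (d + 1) => (0 : ℝ)) ρ' := fun ρ' w => by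
    simp only [one_mul]; exact tsum_prod_M1At_eq_zero_of_centred hLc hr hc cΛ j ρ' w a b
  have h := hasSum_comb_gaugeCharge_plain hLc hr cE cVH cΛ j y ν y' a b (ω := fun _ => (1 : ℝ)) (B := 1) (fun _ => by rw [abs_one]) hζS' hζM'
  simp only [one_mul, mul_zero, Finset.sum_const_zero, add_zero] at h
  exact h

/-! ## §4 Bałaban's centre `ρ_c = toSite (ctrOff (d+1) Lc)`, `Lc` odd (the ℕ bridge) -/

/-- [folklore] The ℕ → ℝ bridge: for odd `Lc` the centred offset `ctrOff` satisfies the real centring hypothesis `2·r_c + 1 = Lc` of INTENT 4∕§2–§3. -/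
theorem ctrOff_centred {Lc : ℕ} (hodd : Odd Lc) (c : Fin (d + 1)) : 2 * ((ctrOff (d + 1) Lc c : ℕ) : ℝ) + 1 = Lc := by
  have h := two_mul_half_add_one hodd
  simp only [ctrOff]
  exact_mod_cast h

/-- NOT IN PRINT; OUR BOOKKEEPING.  **AT BAŁABAN's CENTRE (`Lc` odd) THE `M1` LETTER IS CHARGE-FREE IN THE PLAIN CURRENCY** (§2 at `r = ctrOff (d+1) Lc`, node 5ρ's `two_mul_half_add_one`). -/
theorem tsum_prod_M1At_ctr_eq_zero {Lc : ℕ} [NeZero Lc] (hodd : Odd Lc) (cΛ : ℝ) (j : ℕ) (ρ' : Fin (d + 1)) (w : Site (d + 1)) (a b : Fib d) :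
    ∑' xz : Site (d + 1) × Site (d + 1), M1At d Lc (toSite (ctrOff (d + 1) Lc)) cΛ j ρ' w xz.1 xz.2 a b = 0 :=
  have hLc : 1 ≤ Lc := Nat.one_le_iff_ne_zero.mpr (NeZero.ne Lc)
  tsum_prod_M1At_eq_zero_of_centred hLc (ctrOff_mem_box hLc) (ctrOff_centred hodd) cΛ j ρ' w a b

/-- NOT IN PRINT; OUR BOOKKEEPING.  **THE PLAIN SUB-ROW OF (W-γ) AT BAŁABAN's CENTRE (`Lc` odd), ASSEMBLED** — §3 at `r = ctrOff (d+1) Lc`: the plain charge of the (γ) comb letter per slot is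
`Σ_κ (−2·(cVH·wVH d Lc j)·(stepScale d Lc j·Lc^{d+1})⁻¹·W^{α⁺}_κ(ν,y′))·ζS κ`, given the displayed slot-constancy `ζS` of the plain `S_j`-charges. -/
theorem hasSum_comb_gaugeCharge_plain_ctr {Lc : ℕ} [NeZero Lc] (hodd : Odd Lc) (cE cVH cΛ : ℝ) (j : ℕ) (y : Site (d + 1)) (ν : Fin (d + 1)) (y' : Site (d + 1)) (a b : Fib d)
    {ζS : Fin (d + 1) → ℝ} (hζS : ∀ κ u, ∑' xz : Site (d + 1) × Site (d + 1), SpureRecAt d Lc (toSite (ctrOff (d + 1) Lc)) cE cVH cΛ j κ u xz.1 xz.2 a b = ζS κ) :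
    HasSum (fun xz : Site (d + 1) × Site (d + 1) =>
        (∑ κ, wsum (fun u => ∑' x₂, ∑ κ₂,
              comp (coDressKBmAt (toSite (ctrOff (d + 1) Lc)) Lc (KInvStep (d := d) Lc j))
                (dM (coDressKBmAt (toSite (ctrOff (d + 1) Lc)) Lc (KInvStep (d := d) Lc j)) Lc (SpureRecAt d Lc (toSite (ctrOff (d + 1) Lc)) cE cVH cΛ j)
                  (M1At d Lc (toSite (ctrOff (d + 1) Lc)) cΛ j) ν y')
                u x₂ (Sum.inl κ) (Sum.inl κ₂) * gaugeWt Lc y κ₂ x₂) (SpureRecAt d Lc (toSite (ctrOff (d + 1) Lc)) cE cVH cΛ j κ)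
          + ∑ ρ', cwsum Lc (fun w => ∑' x₂, ∑ κ₂,
              comp (coDressKBmAt (toSite (ctrOff (d + 1) Lc)) Lc (KInvStep (d := d) Lc j))
                (dM (coDressKBmAt (toSite (ctrOff (d + 1) Lc)) Lc (KInvStep (d := d) Lc j)) Lc (SpureRecAt d Lc (toSite (ctrOff (d + 1) Lc)) cE cVH cΛ j)
                  (M1At d Lc (toSite (ctrOff (d + 1) Lc)) cΛ j) ν y')
                ((Lc : ℤ) • w) x₂ (Sum.inr ρ') (Sum.inl κ₂) * gaugeWt Lc y κ₂ x₂) (M1At d Lc (toSite (ctrOff (d + 1) Lc)) cΛ j ρ')) xz.1 xz.2 a b)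
      (∑ κ, ((-(2 * (cVH * wVH d Lc j) * (stepScale d Lc j * (Lc : ℝ) ^ (d + 1))⁻¹)) *
            ∑' u, colH (coDressKBmAt (toSite (ctrOff (d + 1) Lc)) Lc (KInvStep (d := d) Lc j)) Lc ν y' κ u
              * ((if y' + Pi.single ν 1 = y then (1 / 2 : ℝ) else 0) - (if blk Lc (u + Pi.single κ 1) = y then (1 / 2 : ℝ) else 0))) * ζS κ) :=
  have hLc : 1 ≤ Lc := Nat.one_le_iff_ne_zero.mpr (NeZero.ne Lc)
  hasSum_comb_gaugeCharge_plain_centred hLc (ctrOff_mem_box hLc) (ctrOff_centred hodd) cE cVH cΛ j y ν y' a b hζS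

end Summit.QuantumFields.BalabanUV.Beta.GAN24.WardGammaPlainRowCentred

end
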